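import Literature.AlgebraicGeometry.HodgeTheory.BettiPicardNumberBounds
import Literature.AlgebraicGeometry.HodgeTheory.HypersurfaceHodgeFiltrationProofs
import Literature.AlgebraicGeometry.Motives.SmoothHypersurfaceExistenceProofs
import HarnessLib

/-!
# Smooth hypersurfaces `Y ⊂ ℙ^{m+1}_ℂ` of degree `d ≥ m + 2`: `h^{m,0}(Y) ≥ 1`, so `Hg(Hᵐ(Y))(K) ≠ 1`, `Y` is not of Hodge–Tate type, and (even `m`)
# `Hᵐ(Y; ℚ)` is not spanned by Hodge classes; in every dimension `m ≥ 1` there is a smooth projective `m`-fold with non-trivial middle Hodge group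
# (Voisin II §6.1.3 Cor. 6.12, Rem. 6.26; Hartshorne II Ex. 8.20.3; Green–Griffiths–Kerr §I.C p. 45)

Family `hodge`, lane `lit-hodgefound` (Track 2 foundations library; Layers A1/A4), layer `Literature/AlgebraicGeometry/HodgeTheory`.  THEOREMS ONLY (no definition,
no named fact, no instance; D-0026 net debt `0`).  The seat's g24-#8 (`Hg(Hᵏ(X))(K) = 1 ⟺` no off-diagonal Hodge number of `Hᵏ(X)`) and g24-#10 (`ρ + 2p_g ≤ b₂`) READ
ON SMOOTH HYPERSURFACES through the tree's PROVED `Voisin2003_hypersurface_hodgePQ_zero_ne_bot_holds` («`H^{0,m} ≠ 0` in every Hodge model of a smooth hypersurface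
`Y ⊂ ℙ^{m+1}_ℂ` of degree `d ≥ m + 2`», Voisin II §6.1.3 / Rem. 6.26 with Hartshorne II Ex. 8.20.3 `ω_Y ≅ 𝒪_Y(d − m − 2)`, `p_g(Y) ≥ 1`; the residue forms `Res_Y(PΩ/F)`),
and g24-#4's model-free Hodge numbers: **`h^{0,m}(Hᵐ(Y)) = h^{m,0}(Hᵐ(Y)) ≥ 1`**, hence **`Hg(Hᵐ(Y))(K) ≠ 1`** for every field `K ⊇ ℚ` (quartic surfaces, quintic
threefolds, sextic fourfolds, …), `Y` is NOT of Hodge–Tate type, for even `m = 2p` **`Hdgᵖ(Hᵐ(Y)) ≠ Hᵐ(Y; ℚ)`**, and for surfaces (`m = 2`, `d ≥ 4`) `p_g(Y) ≥ 1`,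
`ρ(Y) < b₂(Y)` and a rational class of degree `2` that is not a divisor class exists.  With the tree's PROVED existence of smooth hypersurfaces of every degree
(`exists_isSmoothHypersurface_holds`): **in every dimension `m ≥ 1` there is a smooth projective complex `m`-fold `X` with `h^{m,0}(X) ≥ 1`, not of Hodge–Tate type,
whose middle Hodge group `Hg(Hᵐ(X))(K)` is non-trivial.**

THE PRINTS.  C. Voisin (2003) [VoisinHodgeII2003] §6.1.2 (6.7), §6.1.3 Cor. 6.12 (the Hodge filtration of a hypersurface by the pole order), §6.3.1 Rem. 6.26 (PDF p0170:
«if `d ≥ n + 1`, we have … `F^p𝓗^{n−1} ≠ 𝓗^{n−1}` for every `p ≥ 1`»).  R. Hartshorne (1977) [Hartshorne1977] II Example 8.20.3 (`ω_Y ≅ 𝒪_Y(d − n − 1)` for a hypersurface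
of degree `d` in `ℙⁿ`; `p_g ≥ 1` iff `d ≥ n + 1`).  M. Green, P. Griffiths, M. Kerr (2012) [GreenGriffithsKerr2012] §I.C p0045.  D. Arapura (2012) [Arapura2012] §11.2 (PDF p0177;
the table of `p_g`, `h^{11}` of surfaces of degree `d` in `ℙ³`, PDF p0175).

THE OBJECTS (all the tree's).  `Y : SchemeOver ℂ`, `hY : IsSmoothHypersurface m d Y` (a smooth hypersurface of dimension `m` and degree `d` in `ℙ^{m+1}_ℂ`),
`hX : IsSmoothProjective m Y` (e.g. `hY.1`), `hHD : exists_isReal_hodgeModel`; `Hᵏ(Y) = BettiUniverse.hodge hHD hX k` with `hodgeNumber`, `hodgeClasses`,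
`hodgeGroupBaseChange K`; `bettiCohomology`, `complexBetti`, `algebraicClasses`, `ofRatClass`; `HodgeModel.hodgePQ`, `BettiUniverse.realHodgeModel`.

WHAT IS PROVED.
* §1 **`IsSmoothHypersurface.one_le_hodgeNumber_hodge_zero_top`** (`h^{0,m}(Hᵐ(Y)) ≥ 1`), **`IsSmoothHypersurface.one_le_hodgeNumber_hodge_top_zero`** (`h^{m,0}(Hᵐ(Y)) ≥ 1`).
* §2 **`IsSmoothHypersurface.hodgeGroupBaseChange_hodge_ne_bot`** (`Hg(Hᵐ(Y))(K) ≠ 1`), `IsSmoothHypersurface.not_hodgeTateType`,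
  `IsSmoothHypersurface.hodgeClasses_hodge_ne_top` (`m = 2p`: `Hdgᵖ(H^{2p}(Y)) ≠ ⊤`), `IsSmoothHypersurface.finrank_hodgeClasses_hodge_lt_finrank` (`dim_ℚ Hdgᵖ < b_{2p}`).
* §3 SURFACES `Y_d ⊂ ℙ³`, `d ≥ 4`: `IsSmoothHypersurface.one_le_hodgeNumber_hodge_two_two_zero` (`p_g ≥ 1`), `IsSmoothHypersurface.finrank_hodgeClasses_hodge_two_lt_finrank` (`ρ < b₂`),
  `IsSmoothHypersurface.exists_ofRatClass_not_mem_algebraicClasses_one` (a rational non-divisor class).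
* §4 EXISTENCE IN EVERY DIMENSION: **`exists_isSmoothProjective_one_le_hodgeNumber_hodge_top_zero`**, `exists_isSmoothProjective_not_hodgeTateType`,
  **`exists_isSmoothProjective_hodgeGroupBaseChange_hodge_ne_bot`** (`m ≥ 1`: a smooth projective `m`-fold with `Hg(Hᵐ)(K) ≠ 1`).

DEVIATIONS / SCOPE.  Only `h^{m,0} ≥ 1` is used (not the exact value `C(d−1, m+1)`); degrees `d ≤ m + 1` (Fano and Calabi–Yau boundary `d = m + 2` included above) are not
discussed.  No definitions.

## References
* [VoisinHodgeII2003] C. Voisin, *Hodge Theory and Complex Algebraic Geometry II* (2003) — §6.1.2 (6.7), §6.1.3 Cor. 6.12, §6.3.1 Rem. 6.26 (PDF p. 170).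
* [Hartshorne1977] R. Hartshorne, *Algebraic Geometry* (1977) — II Example 8.20.3.
* [GreenGriffithsKerr2012] M. Green, P. A. Griffiths, M. Kerr, *Mumford–Tate Groups and Domains* (2012) — §I.C p. 45.
* [Arapura2012] D. Arapura, *Algebraic Geometry over the Complex Numbers* (2012) — §11.1 (PDF p. 175), §11.2 (PDF p. 177).

## Provenance
Lane `lit-hodgefound` (Hodge path, Track 2), prover seat `lit-hodgefound-p29` (generation 24), self-proposed row g24-#13 (the gen-24 series read on hypersurfaces).
-/

noncomputable section

open scoped TensorProduct
open CategoryTheory Module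
open Literature.AlgebraicTopology.SingularHomology

namespace Literature.AlgebraicGeometry.Motives.IsSmoothHypersurface

open Literature.AlgebraicGeometry.Motives
open Literature.AlgebraicGeometry.Motives.HodgeStructure
open Literature.AlgebraicGeometry.HodgeTheory

universe w

variable {m d : ℕ} {Y : SchemeOver ℂ}

/-! ### §1 `h^{0,m}(Y) = h^{m,0}(Y) ≥ 1` for `d ≥ m + 2` -/

/-- **`h^{0,m}(Hᵐ(Y)) ≥ 1` for a smooth hypersurface `Y ⊂ ℙ^{m+1}_ℂ` of degree `d ≥ m + 2`, `m ≥ 1`** (`H^{0,m} ≠ 0` in the real Hodge model, the tree's proved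
`Voisin2003_hypersurface_hodgePQ_zero_ne_bot_holds`, read through g24-#4's model-free Hodge numbers). [cite: VoisinHodgeII2003, §6.1.3 Cor. 6.12 and §6.3.1 Rem. 6.26 (PDF p. 170)]
[cite: Hartshorne1977, II Example 8.20.3] -/
theorem one_le_hodgeNumber_hodge_zero_top (hY : IsSmoothHypersurface m d Y) (hm : 1 ≤ m) (hd : m + 2 ≤ d) (hHD : exists_isReal_hodgeModel)
    (hX : IsSmoothProjective m Y) : 1 ≤ (BettiUniverse.hodge hHD hX m).hodgeNumber 0 m := by
  haveI : Module.Finite ℂ (complexBetti Y m) := finite_complexBetti_of_isSmoothProjective hX m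
  haveI : Module.Finite ℂ (singularCohomology ℂ ℂ (BettiUniverse.realHodgeModel hHD hX).carrier m) :=
    Module.Finite.of_surjective ((BettiUniverse.realHodgeModel hHD hX).pullback m).hom ((BettiUniverse.realHodgeModel hHD hX).pullback_surjective m)
  have h := BettiUniverse.hodgeNumber_hodge_eq_finrank_hodgePQ hHD hX (BettiUniverse.realHodgeModel hHD hX) (k := m) (p := 0) (q := m) (zero_add m)
  have h1 : 1 ≤ Module.finrank ℂ ((BettiUniverse.realHodgeModel hHD hX).hodgePQ m 0 m) :=
    Submodule.one_le_finrank_iff.2 (Voisin2003_hypersurface_hodgePQ_zero_ne_bot_holds m d hm hd Y hY _)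
  rw [← h] at h1
  exact_mod_cast h1

/-- **`h^{m,0}(Hᵐ(Y)) ≥ 1`** (`p_g(Y) ≥ 1`; Hodge symmetry). [cite: Hartshorne1977, II Example 8.20.3] [cite: VoisinHodgeII2003, §6.3.1 Rem. 6.26 (PDF p. 170)] -/
theorem one_le_hodgeNumber_hodge_top_zero (hY : IsSmoothHypersurface m d Y) (hm : 1 ≤ m) (hd : m + 2 ≤ d) (hHD : exists_isReal_hodgeModel)
    (hX : IsSmoothProjective m Y) : 1 ≤ (BettiUniverse.hodge hHD hX m).hodgeNumber m 0 := by
  rw [BettiUniverse.hodgeNumber_hodge_symm hHD hX m m 0]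
  exact hY.one_le_hodgeNumber_hodge_zero_top hm hd hHD hX

/-! ### §2 `Hg(Hᵐ(Y)) ≠ 1`, not Hodge–Tate, `Hdgᵖ(H^{2p}(Y)) ≠ ⊤` -/

/-- **The middle Hodge group of a smooth hypersurface of degree `d ≥ m + 2` is non-trivial: `Hg(Hᵐ(Y))(K) ≠ 1`**, every field `K ⊇ ℚ` (`h^{m,0} ≠ 0`, g24-#8).
[cite: GreenGriffithsKerr2012, §I.C p. 45 (before Remark (I.C.14))] [cite: VoisinHodgeII2003, §6.3.1 Rem. 6.26 (PDF p. 170)] -/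
theorem hodgeGroupBaseChange_hodge_ne_bot [HodgeTensorFacts.{0, 0}] (hY : IsSmoothHypersurface m d Y) (hm : 1 ≤ m) (hd : m + 2 ≤ d) (hHD : exists_isReal_hodgeModel)
    (hX : IsSmoothProjective m Y) (K : Type w) [Field K] [Algebra ℚ K] [Module.Finite ℚ (bettiCohomology Y m)] :
    (BettiUniverse.hodge hHD hX m).hodgeGroupBaseChange K ≠ ⊥ :=
  BettiUniverse.hodgeGroupBaseChange_hodge_ne_bot_of_hodgeNumber_zero_ne_zero hHD hX K hm (by have := hY.one_le_hodgeNumber_hodge_top_zero hm hd hHD hX; omega)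

/-- **A smooth hypersurface of degree `d ≥ m + 2` is not of Hodge–Tate type.** [cite: VoisinHodgeII2003, §6.3.1 Rem. 6.26 (PDF p. 170)] [cite: Hartshorne1977, II Example 8.20.3] -/
theorem not_hodgeTateType (hY : IsSmoothHypersurface m d Y) (hm : 1 ≤ m) (hd : m + 2 ≤ d) (hHD : exists_isReal_hodgeModel) (hX : IsSmoothProjective m Y) :
    ¬ ∀ k p q : ℕ, p + q = k → p ≠ q → (BettiUniverse.hodge hHD hX k).hodgeNumber p q = 0 := fun h => by
  have h1 := hY.one_le_hodgeNumber_hodge_top_zero hm hd hHD hX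
  have h0 : (BettiUniverse.hodge hHD hX m).hodgeNumber m 0 = 0 := by exact_mod_cast h m m 0 rfl (by omega)
  omega

/-- **Even dimension `m = 2p`: `Hdgᵖ(H^{2p}(Y)) ≠ H^{2p}(Y; ℚ)`** — the middle cohomology of a smooth hypersurface of degree `d ≥ 2p + 2` is not spanned by Hodge classes
(`h^{0,2p} ≥ 1`). [cite: VoisinHodgeII2003, §6.3.1 Rem. 6.26 (PDF p. 170)] [cite: GreenGriffithsKerr2012, §I.C p. 45 (before Remark (I.C.14))] -/
theorem hodgeClasses_hodge_ne_top {p : ℕ} (hY : IsSmoothHypersurface (2 * p) d Y) (hp : 1 ≤ p) (hd : 2 * p + 2 ≤ d) (hHD : exists_isReal_hodgeModel)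
    (hX : IsSmoothProjective (2 * p) Y) : (BettiUniverse.hodge hHD hX (2 * p)).hodgeClasses p ≠ ⊤ := fun h => by
  haveI := BettiUniverse.finite hX (2 * p)
  have h1 := hY.one_le_hodgeNumber_hodge_zero_top (by omega) hd hHD hX
  have h0 := ((BettiUniverse.hodge hHD hX (2 * p)).hodgeClasses_eq_top_iff_forall_hodgeNumber_eq_zero (p := (p : ℤ)) (by push_cast; ring)).1 h
    0 ((2 * p : ℕ) : ℤ) (by exact_mod_cast (show (0 : ℕ) ≠ p by omega))
  omega

/-- **Even dimension: `dim_ℚ Hdgᵖ(H^{2p}(Y)) < b_{2p}(Y)`.** [cite: VoisinHodgeII2003, §6.3.1 Rem. 6.26 (PDF p. 170)] -/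
theorem finrank_hodgeClasses_hodge_lt_finrank {p : ℕ} (hY : IsSmoothHypersurface (2 * p) d Y) (hp : 1 ≤ p) (hd : 2 * p + 2 ≤ d) (hHD : exists_isReal_hodgeModel)
    (hX : IsSmoothProjective (2 * p) Y) :
    Module.finrank ℚ ((BettiUniverse.hodge hHD hX (2 * p)).hodgeClasses p) < Module.finrank ℚ (bettiCohomology Y (2 * p)) := by
  haveI := BettiUniverse.finite hX (2 * p)
  refine lt_of_le_of_ne (Submodule.finrank_le _) fun h => hY.hodgeClasses_hodge_ne_top hp hd hHD hX ?_
  exact (BettiUniverse.finrank_hodgeClasses_hodge_eq_finrank_iff hHD hX p).1 h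

/-! ### §3 Surfaces `Y_d ⊂ ℙ³` of degree `d ≥ 4`: `p_g ≥ 1`, `ρ < b₂` -/

/-- **`p_g(Y_d) ≥ 1` for a smooth surface `Y_d ⊂ ℙ³` of degree `d ≥ 4`** (`p_g = C(d−1, 3)`). [cite: Hartshorne1977, II Example 8.20.3] [cite: Arapura2012, §11.1 (PDF p. 175)] -/
theorem one_le_hodgeNumber_hodge_two_two_zero (hY : IsSmoothHypersurface 2 d Y) (hd : 4 ≤ d) (hHD : exists_isReal_hodgeModel) (hX : IsSmoothProjective 2 Y) :
    1 ≤ (BettiUniverse.hodge hHD hX 2).hodgeNumber 2 0 := by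
  exact_mod_cast hY.one_le_hodgeNumber_hodge_top_zero (by norm_num) hd hHD hX

/-- **`ρ(Y_d) < b₂(Y_d)`** for `d ≥ 4` (`ρ + 2p_g ≤ b₂`, `p_g ≥ 1`). [cite: Arapura2012, §11.2 (PDF p. 177)] [cite: Hartshorne1977, II Example 8.20.3] -/
theorem finrank_hodgeClasses_hodge_two_lt_finrank (hY : IsSmoothHypersurface 2 d Y) (hd : 4 ≤ d) (hHD : exists_isReal_hodgeModel) (hX : IsSmoothProjective 2 Y) :
    Module.finrank ℚ ((BettiUniverse.hodge hHD hX 2).hodgeClasses 1) < Module.finrank ℚ (bettiCohomology Y 2) :=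
  BettiUniverse.finrank_hodgeClasses_hodge_two_lt_finrank_of_pg_ne_zero hHD hX (by have := hY.one_le_hodgeNumber_hodge_two_two_zero hd hHD hX; omega)

/-- **A smooth surface `Y_d ⊂ ℙ³`, `d ≥ 4`, carries a rational class of degree `2` that is not a divisor class.** [cite: Arapura2012, §11.2 (PDF p. 177)]
[cite: VoisinHodgeII2003, §6.3.1 Rem. 6.26 (PDF p. 170)] -/
theorem exists_ofRatClass_not_mem_algebraicClasses_one (hY : IsSmoothHypersurface 2 d Y) (hd : 4 ≤ d) (hHD : exists_isReal_hodgeModel) (hX : IsSmoothProjective 2 Y) :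
    ∃ v : bettiCohomology Y 2, ofRatClass (ComplexPoints Y) 2 v ∉ algebraicClasses Y 1 := by
  by_contra h
  push Not at h
  have h0 := (forall_ofRatClass_mem_algebraicClasses_one_iff_pg_zero hHD hX).1 h
  have h1 := hY.one_le_hodgeNumber_hodge_two_two_zero hd hHD hX
  omega

end Literature.AlgebraicGeometry.Motives.IsSmoothHypersurface

/-! ### §4 Existence in every dimension -/

namespace Literature.AlgebraicGeometry.HodgeTheory

open Literature.AlgebraicGeometry.Motives
open Literature.AlgebraicGeometry.Motives.HodgeStructure

universe w

/-- **In every dimension `m ≥ 1` there is a smooth projective complex `m`-fold with `h^{m,0} ≥ 1`** (a smooth hypersurface of degree `m + 2` in `ℙ^{m+1}`, which exists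
by the tree's `exists_isSmoothHypersurface_holds`). [cite: Hartshorne1977, II Example 8.20.3] [cite: VoisinHodgeII2003, §6.3.1 Rem. 6.26 (PDF p. 170)] -/
theorem exists_isSmoothProjective_one_le_hodgeNumber_hodge_top_zero {m : ℕ} (hm : 1 ≤ m) (hHD : exists_isReal_hodgeModel) :
    ∃ (X : SchemeOver ℂ) (hX : IsSmoothProjective m X), 1 ≤ (BettiUniverse.hodge hHD hX m).hodgeNumber m 0 := by
  obtain ⟨X, hXh⟩ := exists_isSmoothHypersurface_holds ℂ m (m + 2) hm (by omega)
  exact ⟨X, hXh.1, hXh.one_le_hodgeNumber_hodge_top_zero hm le_rfl hHD hXh.1⟩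

/-- **In every dimension `m ≥ 1` there is a smooth projective complex `m`-fold that is not of Hodge–Tate type.** [cite: Hartshorne1977, II Example 8.20.3]
[cite: GreenGriffithsKerr2012, §I.A p. 33] -/
theorem exists_isSmoothProjective_not_hodgeTateType {m : ℕ} (hm : 1 ≤ m) (hHD : exists_isReal_hodgeModel) :
    ∃ (X : SchemeOver ℂ) (hX : IsSmoothProjective m X), ¬ ∀ k p q : ℕ, p + q = k → p ≠ q → (BettiUniverse.hodge hHD hX k).hodgeNumber p q = 0 := by
  obtain ⟨X, hXh⟩ := exists_isSmoothHypersurface_holds ℂ m (m + 2) hm (by omega)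
  exact ⟨X, hXh.1, hXh.not_hodgeTateType hm le_rfl hHD hXh.1⟩

/-- **In every dimension `m ≥ 1` there is a smooth projective complex `m`-fold whose middle Hodge group `Hg(Hᵐ(X))(K)` is non-trivial**, every field `K ⊇ ℚ`.
[cite: GreenGriffithsKerr2012, §I.C p. 45 (before Remark (I.C.14))] [cite: Hartshorne1977, II Example 8.20.3] -/
theorem exists_isSmoothProjective_hodgeGroupBaseChange_hodge_ne_bot [HodgeTensorFacts.{0, 0}] {m : ℕ} (hm : 1 ≤ m) (hHD : exists_isReal_hodgeModel)
    (K : Type w) [Field K] [Algebra ℚ K] :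
    ∃ (X : SchemeOver ℂ) (hX : IsSmoothProjective m X), ∀ [Module.Finite ℚ (bettiCohomology X m)], (BettiUniverse.hodge hHD hX m).hodgeGroupBaseChange K ≠ ⊥ := by
  obtain ⟨X, hXh⟩ := exists_isSmoothHypersurface_holds ℂ m (m + 2) hm (by omega)
  exact ⟨X, hXh.1, fun {_} => hXh.hodgeGroupBaseChange_hodge_ne_bot hm le_rfl hHD hXh.1 K⟩

end Literature.AlgebraicGeometry.HodgeTheory

end
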